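import Summits.Ventures.PercRepro.C041TriangleLeafStar4CoefA
import Summits.Ventures.PercRepro.C041TriangleLeafStar4CoefB
import Summits.Ventures.PercRepro.C041TriangleLeafStar4CoefC
import Summits.Ventures.PercRepro.C041TriangleLeafStar4CoefD
import Summits.Ventures.PercRepro.C041TriangleLeafStar4CoefE
import Summits.Ventures.PercRepro.C041TriangleLeafStar4CoefF
import Summits.Ventures.PercRepro.C041TriangleLeafStar4CoefG
import Summits.Ventures.PercRepro.C041TriangleLeafStar4CoefH
import Summits.Ventures.PercRepro.C041TriangleLeafStar4CoefI
import Summits.Ventures.PercRepro.C041TriangleLeafStar4CoefJ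
import Summits.Ventures.PercRepro.C041TriangleLeafStar4CoefK
import Summits.Ventures.PercRepro.C041TriangleLeafStar4CoefL
import Summits.Ventures.PercRepro.C041TriangleLeafStar4CoefM
import Summits.Ventures.PercRepro.C041TriangleLeafStar4CoefN
import Summits.Ventures.PercRepro.C041TriangleLeafStar4CoefO
import Summits.Ventures.PercRepro.C041TriangleLeafStar4CoefP
import Summits.Ventures.PercRepro.C041TriangleLeafStar4CoefQ
import Summits.Ventures.PercRepro.C041TriangleLeafStar4CoefR
import Summits.Ventures.PercRepro.C041TriangleLeafStar4CoefS
import Summits.Ventures.PercRepro.C041TriangleLeafStar4CoefT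
import Summits.Ventures.PercRepro.C041TriangleLeafStar4CoefU
import Summits.Ventures.PercRepro.C041TriangleLeafStar4CoefV

/-!
# THEOREM (LEAF × FOUR-LEAF STAR) — the symmetric-monomial sums used by the normal forms of the group lemmas (mine-3, gen 68; C-041.md §21 (bi))
-/

namespace PercRepro

namespace RelaxedTriangle

open TreeClosure

/-- `leafStar4Sym e₁ … k a b c d e = e^k · Σ_{π ∈ G} a^{π e₁} … `: the sum of a monomial over the leaf symmetry group `G`
(every monomial of a class is counted `|Stab|` times). -/
noncomputable def leafStar4Sym (e1 e2 e3 e4 k : ℕ) (a b c d e : ℝ) : ℝ :=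
  e ^ k * (a ^ e1 * b ^ e2 * c ^ e3 * d ^ e4
    + a ^ e1 * b ^ e2 * d ^ e3 * c ^ e4
    + a ^ e1 * c ^ e2 * b ^ e3 * d ^ e4
    + a ^ e1 * c ^ e2 * d ^ e3 * b ^ e4
    + a ^ e1 * d ^ e2 * b ^ e3 * c ^ e4
    + a ^ e1 * d ^ e2 * c ^ e3 * b ^ e4
    + b ^ e1 * a ^ e2 * c ^ e3 * d ^ e4
    + b ^ e1 * a ^ e2 * d ^ e3 * c ^ e4
    + b ^ e1 * c ^ e2 * a ^ e3 * d ^ e4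
    + b ^ e1 * c ^ e2 * d ^ e3 * a ^ e4
    + b ^ e1 * d ^ e2 * a ^ e3 * c ^ e4
    + b ^ e1 * d ^ e2 * c ^ e3 * a ^ e4
    + c ^ e1 * a ^ e2 * b ^ e3 * d ^ e4
    + c ^ e1 * a ^ e2 * d ^ e3 * b ^ e4
    + c ^ e1 * b ^ e2 * a ^ e3 * d ^ e4
    + c ^ e1 * b ^ e2 * d ^ e3 * a ^ e4
    + c ^ e1 * d ^ e2 * a ^ e3 * b ^ e4
    + c ^ e1 * d ^ e2 * b ^ e3 * a ^ e4
    + d ^ e1 * a ^ e2 * b ^ e3 * c ^ e4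
    + d ^ e1 * a ^ e2 * c ^ e3 * b ^ e4
    + d ^ e1 * b ^ e2 * a ^ e3 * c ^ e4
    + d ^ e1 * b ^ e2 * c ^ e3 * a ^ e4
    + d ^ e1 * c ^ e2 * a ^ e3 * b ^ e4
    + d ^ e1 * c ^ e2 * b ^ e3 * a ^ e4)

end RelaxedTriangle

end PercRepro
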